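import Mathlib.LinearAlgebra.Matrix.SpecialLinearGroup
import Mathlib.Algebra.CharP.Defs
import Mathlib.Data.ZMod.Basic
import HarnessLib

/-!
# EXT-CRIT in characteristic 3: stable additive functions on the kernel of `G ↠ SL₂(ℤ/q)`, `q` prime `≠ 3`,
# extend to `G` (derived reading of «`SL₂(p)` has trivial Schur multiplier», Gorenstein 1982 Prop. 4.232 (i))

Topic `GroupTheory/SpecificGroups`; namespace `Literature.GroupTheory.SpecificGroups`.  STATEMENT ONLY (one named
fact, no proof here), the characteristic-`3` twin of the sibling fact
`sl2ZModOddPrime_existsUnique_extension_of_stable_character` (`SL2OddPrimeStableCharacterExtension.lean`, `2`-torsion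
coefficients, `q` odd; PROVED in the tree via `Literature/GroupTheory/CentralExtensionDicyclicTransfer.lean`).

THE STATEMENT (binder shape = the hypothesis `hF` of the BSD tree file
`Summits/BirchSwinnertonDyer/BirchSwinnertonDyer/Theorems/ManinLocalTwoThreeVertexExtensionOdd.lean` with `CharP K 2`
replaced by `CharP K 3`, universally quantified over the prime `q ≠ 3`): for a prime `q ≠ 3`, a group `G` with a
SURJECTIVE homomorphism `π : G →* SL(2, ZMod q)`, a field `K` of characteristic `3` and a function `φ : G → K` that is
additive on `ker π` and `G`-invariant there (`φ (g n g⁻¹) = φ n`), there is an additive `Φ : G → K` agreeing with `φ` on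
`ker π`.

DERIVATION FROM PRINT (why this is a theorem; (E1)–(E3) as in the sibling file).  (E1) `Q := SL₂(𝔽_q)`, `q` prime, has
TRIVIAL Schur multiplier `H₂(Q, ℤ) = 0` [Gorenstein 1982, Prop. 4.232 (i), p. 288: «SL₂(p), p a prime, has trivial Schur
multiplier» — via Prop. 4.227/4.231: the Sylow subgroups of `SL₂(p)` are cyclic (odd primes, and `p` itself for `n = 1`) or
quaternion; Prop. 4.233 for prime powers `≠ 4, 9`].  (E2) `H₁(Q, ℤ) = Q^{ab}` is `0` for `q ≥ 5` (`Q` perfect), `ℤ/2` for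
`q = 2` (`Q ≅ S₃`) and `ℤ/3` for `q = 3` — so for `q ≠ 3` it has no `3`-torsion, and for the trivial `Q`-module `K`
(an `𝔽₃`-vector space) universal coefficients give `H¹(Q, K) = Hom(Q^{ab}, K) = 0` and
`H²(Q, K) = Hom(H₂ Q, K) ⊕ Ext(Q^{ab}, K) = 0` [Brown 1982, III.1 Ex. 2–3].  (E3) The five-term exact sequence of
Hochschild–Serre [Brown 1982, VII (6.3)–(6.4), p. 178] for `1 → N → G → Q → 1`, `N = ker π`, with coefficients `K`:
`0 → H¹(Q, K) → H¹(G, K) → H¹(N, K)^Q → H²(Q, K)`; a `G`-invariant additive `φ|_N` is a class in `H¹(N, K)^Q = Hom(N, K)^G`,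
and `H²(Q, K) = 0` says it is the restriction of some `Φ ∈ H¹(G, K) = Hom(G, K)` (unique, by `H¹(Q, K) = 0`; uniqueness is
not part of the typed statement, which follows the consumer's binder).  The prime `q = 3` IS excluded:
`Ext(ℤ/3, 𝔽₃) ≠ 0` (`SL₂(𝔽₃)^{ab} = ℤ/3`), and indeed the degree-`3` sign-type character of the `3`-cover obstructs.
Elementary proof route (for the `_holds` theorem, not used here): generalise the tree's dicyclic-transfer argument
(`CentralExtensionDicyclicTransfer.lean`) from exponent `2` to exponent `3` — its step (A) needs no parity of `k`
(`[H̄, H̄] = ⟨α² z₁⁻¹⟩`, `c^k = 1` since `α^{2k} = z₁^k`), the transfer step (B) works for a central `z` with `z³ = 1` and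
index prime to `3`, and the dicyclic normaliser `Q_{2(q∓1)}` of the cyclic Sylow `3`-subgroup (sign with `3 ∣ q ∓ 1`) has
index `q(q±1)/2` prime to `3`; `q = 2`: `Q = S₃` directly.

WHO USES IT.  BSD cell `bsd-f2-manin`, es lens MEMO-es §32.4 (es g19, ask F-es-27‴, 2026-08-28T16:05:40Z): the vertex
`SL₂(𝔽_q)` of the `p = 3` parabolic relative-Ihara statement E-es-36x(3, q, 1) (`RelativeIharaShiftVanishingParOddExact 3 q 1`,
leaf `Summits/…/ManinAdditive/RelativeIharaShiftVanishingParabolic.lean`) needs «`H¹ = H² = 0` with `𝔽₃`-coefficients for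
every prime `q ≠ 3`, including `q = 2`», in exactly this extension form.  Presearch (typer g13, 2026-08-28): corpus hybrid
«Schur multiplier SL(2,q) trivial except q = 4 and 9» → [corpus: book:gorenstein1982-finite-simple-groups p. 288] Prop.
4.232/4.233 (read); galaxy «Schur multiplier of SL(2,q)|…» → 1 panama hit (Groups St Andrews 1985 front matter, not
pertinent); the extension-form statement itself is a derived reading, not verbatim print.

## References

* [Gorenstein1982] D. Gorenstein, *Finite Simple Groups*, Plenum 1982, Prop. 4.232 (i) and Prop. 4.233 (p. 288).
  [cite: Gorenstein1982, Prop. 4.232 (i) (p. 288) (SL_2(p), p prime, has trivial Schur multiplier)]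
* [Brown1982CohomologyGroups] K. S. Brown, *Cohomology of Groups*, GTM 87, VII (6.3)–(6.4) (p. 178), III.1 Ex. 2–3.
  [cite: Brown1982CohomologyGroups, VII (6.3)-(6.4) (Hochschild-Serre five-term exact sequence), III.1 Ex. 2-3]
-/

open scoped MatrixGroups

namespace Literature.GroupTheory.SpecificGroups

/-- **EXT-CRIT for `SL₂(𝔽_q)`, `q` a prime `≠ 3`, characteristic-`3` coefficients** (derived reading of Gorenstein 1982
Prop. 4.232 (i) «`SL₂(p)` has trivial Schur multiplier» through universal coefficients and the Hochschild–Serre five-term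
exact sequence, Brown GTM 87 VII (6.3)–(6.4); derivation (E1)–(E3) in the module docstring).  For every prime `q ≠ 3`,
every group `G` with a surjective homomorphism `π : G →* SL(2, ZMod q)`, every field `K` of characteristic `3` and every
`φ : G → K` that is additive on `ker π` and `G`-invariant there, some additive `Φ : G → K` agrees with `φ` on `ker π`.
Binder shape = the hypothesis `hF` of the BSD tree's `…Theorems.ManinLocalTwoThree.shiftInvariantIsOldUpToDiamond_odd_of_extensionFact`
with `CharP K 3`.  Not verbatim print; `q = 3` excluded (`SL₂(𝔽₃)^{ab} = ℤ/3`, `Ext(ℤ/3, 𝔽₃) ≠ 0`); `q = 2` included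
(`SL₂(𝔽₂) ≅ S₃`, `H¹(S₃, 𝔽₃) = H²(S₃, 𝔽₃) = 0`).
[cite: Gorenstein1982, Prop. 4.232 (i) (p. 288); Brown1982CohomologyGroups, VII (6.3)-(6.4), III.1 Ex. 2-3 (derived reading: extension of stable characters from `H^1 = H^2 = 0` with F_3-coefficients; BSD cell bsd-f2-manin MEMO-es §32.4, ask F-es-27‴)] -/
def sl2ZModPrime_exists_extension_of_stable_character_charThree : Prop :=
  ∀ (q : ℕ), q.Prime → q ≠ 3 →
  ∀ (G : Type) [Group G] (K : Type) [Field K] [CharP K 3] (π : G →* SL(2, ZMod q)),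
    Function.Surjective π → ∀ φ : G → K,
    (∀ n ∈ π.ker, ∀ n' ∈ π.ker, φ (n * n') = φ n + φ n') →
    (∀ g : G, ∀ n ∈ π.ker, φ (g * n * g⁻¹) = φ n) →
    ∃ Φ : G → K, (∀ g g' : G, Φ (g * g') = Φ g + Φ g') ∧ ∀ n ∈ π.ker, Φ n = φ n

end Literature.GroupTheory.SpecificGroups
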